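import Summits.ResolutionOfSingularities.KangarooAtlas.MizutaniOdaEquality
import Literature.AlgebraicGeometry.Resolution.HironakaGroupSchemeMultiplicity
import Mathlib.RingTheory.GradedAlgebra.HomogeneousLocalization
import Mathlib.RingTheory.MvPolynomial.Homogeneous
import HarnessLib

/-!
# Mizutani's conjecture — the multiplicity of a form at a point of `ℙⁿ`, read in the PROJECTIVE local ring

Cell topic `Summits/ResolutionOfSingularities/KangarooAtlas` (pub-rosobs); namespace
`Summit.ResolutionOfSingularities.KangarooAtlas.Mizutani`.  Companion to the Lean transcription of the in-house
note MIZUTANI-PROOF-g59 (AI-written, AI-audited; *AI review is weaker than expert review*; not a resolution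
theorem).

The res-hironaka typing file `Literature/…/HironakaGroupSchemeMultiplicity.lean` transcribes Hironaka's graded
algebra `U(𝔭) = ⊕_d U_d(𝔭)`, `U_d(𝔭) = {φ ∈ S_d : ν_𝔭(φ) ≥ d}` ([H4] Hironaka, J. Math. Kyoto Univ. 10 (1970) p. 154
L24–29: «whose homogeneous part of degree `d` is `{φ ∈ K[X]_d | ν_{x'}(φ/X_0^d) ≥ d}`, … `x'` viewed as a point of
`Proj(K[X])`»; [Miz] Mizutani 1973 p. 85 L23–25: `mult_p(Proj(S/fS)) ≥ m`) through the SYMBOLIC POWER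
`symbPow k 𝔭 d = {f | ∃ s ∉ 𝔭, s·f ∈ 𝔭^d} = 𝔭^d S_𝔭 ∩ S`, i.e. it reads the order in the local ring `S_𝔭` of the
AFFINE cone `𝔸^{n+1}` at the generic point of the line `V(𝔭)`, whereas Hironaka's `ν_{x'}` is the order in the local
ring `𝒪_{ℙⁿ,x'} = 𝒪_{Proj S,𝔭}` of the PROJECTIVE space at the point (the item (G3) «definitional residue» of the
cell's reviewer map MIZUTANI-LEAN.md §2).  THIS FILE PROVES THAT THE TWO READINGS AGREE:

* `𝒪_{Proj S,𝔭}` is Mathlib's `HomogeneousLocalization.AtPrime 𝒜 𝔭` (`𝒜 = homogeneousSubmodule`, the grading by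
  degree; this IS the stalk of `Proj S` at `𝔭`, Mathlib `AlgebraicGeometry.Proj.stalkIso'`), a local ring with maximal
  ideal `𝔪_{Proj,𝔭}`; for a linear form `ℓ ∉ 𝔭` (Hironaka's `X_0`; every point of `ℙⁿ` has a variable `X_i ∉ 𝔭`)
  and a form `φ` of degree `m`, `projGerm 𝔭 ℓ m φ = φ/ℓ^m ∈ 𝒪_{Proj S,𝔭}`;
* **`mem_symbPow_iff_projGerm_mem_pow`**: for every HOMOGENEOUS prime `𝔭`, every form `φ ∈ S_m` and every `d`,
  `φ ∈ symbPow k 𝔭 d ↔ φ/ℓ^m ∈ 𝔪_{Proj,𝔭}^d` — «`ν_{x'}(φ/ℓ^m) ≥ d`» literally, `ν` the `𝔪`-adic order of the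
  regular local ring `𝒪_{ℙⁿ,x'}`.  The corollaries for points of `ℙⁿ_k` (a variable `X_i ∉ 𝔭`; Hironaka's `U_d(𝔭)`
  verbatim; the invariant additive forms `hirForms` / Oda's `invForms` read in `𝒪_{ℙⁿ,𝔭}`) are in the companion file
  `MizutaniProjectiveOrderPoint.lean`.

Proof.  `⇐`: the value map `𝒪_{Proj S,𝔭} → S_𝔭` is local and `ℓ` is a unit of `S_𝔭`.  `⇒` (the content: `𝔪^d S_𝔭 ∩
𝒪_{Proj S,𝔭} = 𝔪^d`, i.e. what faithful flatness of the cone `Spec S_𝔭 → Spec 𝒪_{Proj S,𝔭}` would give) by graded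
bookkeeping: if `s φ ∈ 𝔭^d` with `s ∉ 𝔭` then some homogeneous component `t = s_j ∉ 𝔭` has `t φ = (sφ)_{j+m} ∈ 𝔭^d`
(`𝔭^d` is a homogeneous ideal); by induction on `d` over `𝔭^{d+1} = 𝔭^d · 𝔭`, EVERY homogeneous `g ∈ 𝔭^d ∩ S_m` has
`g/ℓ^m ∈ 𝔪^d` (`projGerm_decompose_mem_pow`: the degree-`N` component of `y z`, `y ∈ 𝔭^d`, `z ∈ 𝔭 ∩ S_i`, is
`y_{N−i} z`, and `y_{N−i} ∈ 𝔭^d`); finally `φ/ℓ^m = (t/ℓ^j)⁻¹ · (tφ/ℓ^{j+m})` with `t/ℓ^j` a unit.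

What remains DEFINITIONAL after this file (for the record): that the multiplicity `mult_p(Proj(S/fS))` of the
hypersurface `f = 0` at `p` (Mizutani's words) is the order `ν_p(f)` (Hironaka's words, [H4] p. 154) — the equality of
the Samuel multiplicity of `𝒪/(f)` with the order of `f` in the regular local ring `𝒪 = 𝒪_{ℙⁿ,p}` — and Mizutani's
Def. 1.1 `B_{P,𝔭} := Spec(S/U_+(𝔭)S)` itself.

References: [Hironaka1970NumericalCharacters] p. 154 L24–29, (13.1)–(13.2) p. 168; [Mizutani1973HironakaGroupSchemes]
p. 85 L21–29, Def. 1.1; [Oda1983HironakaGroupSchemeII] §2 p. 1168.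
-/

noncomputable section

open MvPolynomial DirectSum Literature.AlgebraicGeometry.Resolution
  Literature.AlgebraicGeometry.Resolution.HironakaScheme

attribute [local instance] MvPolynomial.gradedAlgebra

namespace Summit.ResolutionOfSingularities.KangarooAtlas.Mizutani

universe u

section ProjectiveOrder

variable {k : Type u} [Field k] {n : ℕ}
  (𝔭 : Ideal (MvPolynomial (Fin (n + 1)) k)) [h𝔭 : 𝔭.IsPrime]

/-- A power of a linear form is a form of that degree (`ℓ ∈ S_1 ⇒ ℓ^m ∈ S_m`). [folklore] -/
theorem pow_mem_homogeneousSubmodule_of_mem_one {ℓ : MvPolynomial (Fin (n + 1)) k}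
    (hℓ : ℓ ∈ homogeneousSubmodule (Fin (n + 1)) k 1) (m : ℕ) :
    ℓ ^ m ∈ homogeneousSubmodule (Fin (n + 1)) k m := by
  have h := SetLike.pow_mem_graded m hℓ
  simpa only [smul_eq_mul, mul_one] using h

variable {𝔭} in
/-- Off a prime, powers stay off it. [folklore] -/
theorem pow_not_mem_of_not_mem {ℓ : MvPolynomial (Fin (n + 1)) k} (hℓ𝔭 : ℓ ∉ 𝔭) (m : ℕ) : ℓ ^ m ∉ 𝔭 :=
  fun h => hℓ𝔭 (h𝔭.mem_of_pow_mem m h)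

/-- **The germ `φ/ℓ^m ∈ 𝒪_{Proj S,𝔭}`** of a form `φ` of degree `m` at the point `𝔭`, in the chart `ℓ ≠ 0` (`ℓ` a
linear form not in `𝔭`; Hironaka's `φ/X_0^d`, [H4] p. 154 L27).  Here `𝒪_{Proj S,𝔭}` is Mathlib's
`HomogeneousLocalization.AtPrime (homogeneousSubmodule (Fin (n+1)) k) 𝔭`, the ring of degree-zero fractions `g/s`,
`s ∉ 𝔭` homogeneous, `deg g = deg s` — the stalk of `Proj S` at `𝔭`.
[cite: Hironaka1970NumericalCharacters, p. 154 L24–29 (ν_{x'}(φ/X_0^d))] -/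
def projGerm (ℓ : MvPolynomial (Fin (n + 1)) k) (hℓ : ℓ ∈ homogeneousSubmodule (Fin (n + 1)) k 1)
    (hℓ𝔭 : ℓ ∉ 𝔭) (m : ℕ) (φ : MvPolynomial (Fin (n + 1)) k)
    (hφ : φ ∈ homogeneousSubmodule (Fin (n + 1)) k m) :
    HomogeneousLocalization.AtPrime (homogeneousSubmodule (Fin (n + 1)) k) 𝔭 :=
  HomogeneousLocalization.mk
    { deg := m
      num := ⟨φ, hφ⟩
      den := ⟨ℓ ^ m, pow_mem_homogeneousSubmodule_of_mem_one hℓ m⟩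
      den_mem := pow_not_mem_of_not_mem hℓ𝔭 m }

variable {𝔭}
variable {ℓ : MvPolynomial (Fin (n + 1)) k} (hℓ : ℓ ∈ homogeneousSubmodule (Fin (n + 1)) k 1) (hℓ𝔭 : ℓ ∉ 𝔭)

/-- The value of the germ `φ/ℓ^m` in `S_𝔭` is the fraction `φ/ℓ^m`. [folklore] -/
theorem val_projGerm (m : ℕ) (φ : MvPolynomial (Fin (n + 1)) k)
    (hφ : φ ∈ homogeneousSubmodule (Fin (n + 1)) k m) :
    (projGerm 𝔭 ℓ hℓ hℓ𝔭 m φ hφ).val =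
      Localization.mk φ (⟨ℓ ^ m, pow_not_mem_of_not_mem hℓ𝔭 m⟩ : 𝔭.primeCompl) :=
  rfl

include hℓ hℓ𝔭 in
/-- The germ only depends on the polynomial (proof-irrelevance bookkeeping). [folklore] -/
theorem projGerm_congr {m : ℕ} {φ ψ : MvPolynomial (Fin (n + 1)) k}
    (hφ : φ ∈ homogeneousSubmodule (Fin (n + 1)) k m) (hψ : ψ ∈ homogeneousSubmodule (Fin (n + 1)) k m)
    (h : φ = ψ) : projGerm 𝔭 ℓ hℓ hℓ𝔭 m φ hφ = projGerm 𝔭 ℓ hℓ hℓ𝔭 m ψ hψ := by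
  subst h
  rfl

/-- `0/ℓ^m = 0`. [folklore] -/
theorem projGerm_zero (m : ℕ) :
    projGerm 𝔭 ℓ hℓ hℓ𝔭 m 0 (Submodule.zero_mem _) = 0 := by
  rw [HomogeneousLocalization.ext_iff_val, val_projGerm, HomogeneousLocalization.val_zero,
    Localization.mk_zero]

/-- `(φ + ψ)/ℓ^m = φ/ℓ^m + ψ/ℓ^m`. [folklore] -/
theorem projGerm_add (m : ℕ) (φ ψ : MvPolynomial (Fin (n + 1)) k)
    (hφ : φ ∈ homogeneousSubmodule (Fin (n + 1)) k m) (hψ : ψ ∈ homogeneousSubmodule (Fin (n + 1)) k m) :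
    projGerm 𝔭 ℓ hℓ hℓ𝔭 m (φ + ψ) (Submodule.add_mem _ hφ hψ) =
      projGerm 𝔭 ℓ hℓ hℓ𝔭 m φ hφ + projGerm 𝔭 ℓ hℓ hℓ𝔭 m ψ hψ := by
  rw [HomogeneousLocalization.ext_iff_val, HomogeneousLocalization.val_add, val_projGerm, val_projGerm,
    val_projGerm, Localization.add_mk_self]

/-- `(φψ)/ℓ^{a+b} = (φ/ℓ^a)(ψ/ℓ^b)`. [folklore] -/
theorem projGerm_mul {a b c : ℕ} (h : a + b = c) (φ ψ : MvPolynomial (Fin (n + 1)) k)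
    (hφ : φ ∈ homogeneousSubmodule (Fin (n + 1)) k a) (hψ : ψ ∈ homogeneousSubmodule (Fin (n + 1)) k b)
    (hφψ : φ * ψ ∈ homogeneousSubmodule (Fin (n + 1)) k c) :
    projGerm 𝔭 ℓ hℓ hℓ𝔭 c (φ * ψ) hφψ =
      projGerm 𝔭 ℓ hℓ hℓ𝔭 a φ hφ * projGerm 𝔭 ℓ hℓ hℓ𝔭 b ψ hψ := by
  rw [HomogeneousLocalization.ext_iff_val, HomogeneousLocalization.val_mul, val_projGerm, val_projGerm,
    val_projGerm, Localization.mk_mul]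
  congr 1
  exact Subtype.ext (by simp only [Submonoid.coe_mul, ← pow_add, h])

/-- **`φ/ℓ^m` is a unit of `𝒪_{Proj S,𝔭}` iff `φ ∉ 𝔭`.** [folklore] -/
theorem isUnit_projGerm_iff (m : ℕ) (φ : MvPolynomial (Fin (n + 1)) k)
    (hφ : φ ∈ homogeneousSubmodule (Fin (n + 1)) k m) :
    IsUnit (projGerm 𝔭 ℓ hℓ hℓ𝔭 m φ hφ) ↔ φ ∉ 𝔭 := by
  rw [← HomogeneousLocalization.isUnit_iff_isUnit_val, val_projGerm, Localization.mk_eq_mk',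
    IsLocalization.AtPrime.isUnit_mk'_iff (Localization.AtPrime 𝔭) 𝔭]
  rfl

/-- **`φ/ℓ^m ∈ 𝔪_{Proj,𝔭}` iff `φ ∈ 𝔭`** (the maximal ideal of `𝒪_{Proj S,𝔭}` consists of the germs with numerator
in `𝔭`). [folklore] -/
theorem projGerm_mem_maximalIdeal_iff (m : ℕ) (φ : MvPolynomial (Fin (n + 1)) k)
    (hφ : φ ∈ homogeneousSubmodule (Fin (n + 1)) k m) :
    projGerm 𝔭 ℓ hℓ hℓ𝔭 m φ hφ ∈
        IsLocalRing.maximalIdeal (HomogeneousLocalization.AtPrime (homogeneousSubmodule (Fin (n + 1)) k) 𝔭) ↔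
      φ ∈ 𝔭 := by
  rw [IsLocalRing.mem_maximalIdeal, mem_nonunits_iff, isUnit_projGerm_iff, not_not]

/-- The value map `𝒪_{Proj S,𝔭} → S_𝔭` is local: it maps `𝔪_{Proj,𝔭}` into the maximal ideal of `S_𝔭`.
[folklore] -/
theorem map_maximalIdeal_le :
    Ideal.map (algebraMap (HomogeneousLocalization.AtPrime (homogeneousSubmodule (Fin (n + 1)) k) 𝔭)
        (Localization.AtPrime 𝔭))
      (IsLocalRing.maximalIdeal (HomogeneousLocalization.AtPrime (homogeneousSubmodule (Fin (n + 1)) k) 𝔭)) ≤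
      IsLocalRing.maximalIdeal (Localization.AtPrime 𝔭) := by
  refine Ideal.map_le_iff_le_comap.mpr fun x hx => ?_
  rw [Ideal.mem_comap, IsLocalRing.mem_maximalIdeal, mem_nonunits_iff,
    HomogeneousLocalization.algebraMap_apply, HomogeneousLocalization.isUnit_iff_isUnit_val]
  rw [IsLocalRing.mem_maximalIdeal, mem_nonunits_iff] at hx
  exact hx

/-- A power of a homogeneous ideal is homogeneous. [folklore] -/
theorem isHomogeneous_pow {I : Ideal (MvPolynomial (Fin (n + 1)) k)}
    (hI : I.IsHomogeneous (homogeneousSubmodule (Fin (n + 1)) k)) (d : ℕ) :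
    (I ^ d).IsHomogeneous (homogeneousSubmodule (Fin (n + 1)) k) := by
  induction d with
  | zero =>
    intro i r _
    rw [pow_zero, Ideal.one_eq_top]
    exact Submodule.mem_top
  | succ d ih =>
    rw [pow_succ]
    exact ih.mul hI

/-- If every homogeneous component of `x` and of `y` has its germ in an ideal `I` of `𝒪_{Proj S,𝔭}`, then so
does `x + y` (`(x + y)_i = x_i + y_i`). [folklore] -/
theorem projGerm_decompose_add_mem
    (I : Ideal (HomogeneousLocalization.AtPrime (homogeneousSubmodule (Fin (n + 1)) k) 𝔭))
    {x y : MvPolynomial (Fin (n + 1)) k}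
    (hx : ∀ i : ℕ, projGerm 𝔭 ℓ hℓ hℓ𝔭 i (decompose (homogeneousSubmodule (Fin (n + 1)) k) x i)
      (SetLike.coe_mem _) ∈ I)
    (hy : ∀ i : ℕ, projGerm 𝔭 ℓ hℓ hℓ𝔭 i (decompose (homogeneousSubmodule (Fin (n + 1)) k) y i)
      (SetLike.coe_mem _) ∈ I) (i : ℕ) :
    projGerm 𝔭 ℓ hℓ hℓ𝔭 i (decompose (homogeneousSubmodule (Fin (n + 1)) k) (x + y) i)
      (SetLike.coe_mem _) ∈ I := by
  have e : (decompose (homogeneousSubmodule (Fin (n + 1)) k) (x + y) i : MvPolynomial (Fin (n + 1)) k) =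
      decompose (homogeneousSubmodule (Fin (n + 1)) k) x i +
        decompose (homogeneousSubmodule (Fin (n + 1)) k) y i := by
    rw [decompose_add, DirectSum.add_apply, Submodule.coe_add]
  rw [projGerm_congr hℓ hℓ𝔭 _
      (Submodule.add_mem _ (SetLike.coe_mem (decompose (homogeneousSubmodule (Fin (n + 1)) k) x i))
        (SetLike.coe_mem (decompose (homogeneousSubmodule (Fin (n + 1)) k) y i))) e,
    projGerm_add hℓ hℓ𝔭 i _ _
      (SetLike.coe_mem (decompose (homogeneousSubmodule (Fin (n + 1)) k) x i))
      (SetLike.coe_mem (decompose (homogeneousSubmodule (Fin (n + 1)) k) y i))]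
  exact Ideal.add_mem _ (hx i) (hy i)

/-- … and then so does every finite sum. [folklore] -/
theorem projGerm_decompose_sum_mem
    (I : Ideal (HomogeneousLocalization.AtPrime (homogeneousSubmodule (Fin (n + 1)) k) 𝔭))
    {ι : Type*} (s : Finset ι) (f : ι → MvPolynomial (Fin (n + 1)) k)
    (hf : ∀ j ∈ s, ∀ i : ℕ, projGerm 𝔭 ℓ hℓ hℓ𝔭 i
      (decompose (homogeneousSubmodule (Fin (n + 1)) k) (f j) i) (SetLike.coe_mem _) ∈ I) (i : ℕ) :
    projGerm 𝔭 ℓ hℓ hℓ𝔭 i (decompose (homogeneousSubmodule (Fin (n + 1)) k) (∑ j ∈ s, f j) i)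
      (SetLike.coe_mem _) ∈ I := by
  classical
  induction s using Finset.induction_on generalizing i with
  | empty =>
    have e : (decompose (homogeneousSubmodule (Fin (n + 1)) k) (∑ j ∈ (∅ : Finset ι), f j) i :
        MvPolynomial (Fin (n + 1)) k) = 0 := by
      rw [Finset.sum_empty, decompose_zero, DirectSum.zero_apply, Submodule.coe_zero]
    rw [projGerm_congr hℓ hℓ𝔭 _ (Submodule.zero_mem _) e, projGerm_zero]
    exact Ideal.zero_mem _
  | insert j s hjs ihs =>
    have e : (decompose (homogeneousSubmodule (Fin (n + 1)) k) (∑ j' ∈ insert j s, f j') i :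
        MvPolynomial (Fin (n + 1)) k) =
        decompose (homogeneousSubmodule (Fin (n + 1)) k) (f j + ∑ j' ∈ s, f j') i := by
      rw [Finset.sum_insert hjs]
    rw [projGerm_congr hℓ hℓ𝔭 _ (SetLike.coe_mem _) e]
    exact projGerm_decompose_add_mem hℓ hℓ𝔭 I (hf j (Finset.mem_insert_self j s))
      (fun i' => ihs (fun j' hj' => hf j' (Finset.mem_insert_of_mem hj')) i') i

/-- **KEY STEP** (the content of `𝔪^d S_𝔭 ∩ 𝒪_{Proj S,𝔭} ⊆ 𝔪_{Proj,𝔭}^d`): for a homogeneous prime `𝔭`, EVERY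
homogeneous component `r_i` of every `r ∈ 𝔭^d` has `r_i/ℓ^i ∈ 𝔪_{Proj,𝔭}^d`.  By induction on `d` over
`𝔭^{d+1} = 𝔭^d · 𝔭`: the degree-`i` component of `y z_j` (`y ∈ 𝔭^d`, `z_j ∈ 𝔭 ∩ S_j` a homogeneous component of
`z ∈ 𝔭`) is `y_{i−j} z_j` with `y_{i−j} ∈ 𝔭^d`, and `(y_{i−j} z_j)/ℓ^i = (y_{i−j}/ℓ^{i−j}) · (z_j/ℓ^j) ∈ 𝔪^d · 𝔪`.
[folklore] -/
theorem projGerm_decompose_mem_pow (h𝔭h : 𝔭.IsHomogeneous (homogeneousSubmodule (Fin (n + 1)) k)) (d : ℕ) :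
    ∀ r ∈ 𝔭 ^ d, ∀ i : ℕ,
      projGerm 𝔭 ℓ hℓ hℓ𝔭 i (decompose (homogeneousSubmodule (Fin (n + 1)) k) r i) (SetLike.coe_mem _) ∈
        IsLocalRing.maximalIdeal
          (HomogeneousLocalization.AtPrime (homogeneousSubmodule (Fin (n + 1)) k) 𝔭) ^ d := by
  induction d with
  | zero =>
    intro r _ i
    rw [pow_zero, Ideal.one_eq_top]
    exact Submodule.mem_top
  | succ d ih =>
    intro r hr
    rw [pow_succ] at hr
    refine Submodule.mul_induction_on hr (fun y hy z hz => ?_)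
      (fun x y hx hy => projGerm_decompose_add_mem hℓ hℓ𝔭 _ hx hy)
    -- decompose `z ∈ 𝔭` into its homogeneous components `z_j ∈ 𝔭 ∩ S_j`
    classical
    have e : ∀ i : ℕ, (decompose (homogeneousSubmodule (Fin (n + 1)) k) (y * z) i : MvPolynomial (Fin (n + 1)) k) =
        decompose (homogeneousSubmodule (Fin (n + 1)) k)
          (∑ j ∈ (decompose (homogeneousSubmodule (Fin (n + 1)) k) z).support,
            y * (decompose (homogeneousSubmodule (Fin (n + 1)) k) z j : MvPolynomial (Fin (n + 1)) k)) i := by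
      intro i
      rw [← Finset.mul_sum, sum_support_decompose]
    intro i
    rw [projGerm_congr hℓ hℓ𝔭 _ (SetLike.coe_mem _) (e i)]
    refine projGerm_decompose_sum_mem hℓ hℓ𝔭 _ _ _ (fun j _ i => ?_) i
    -- the homogeneous case: `(y z_j)_i = y_{i-j} z_j` if `j ≤ i`, else `0`
    by_cases hji : j ≤ i
    · have e' : (decompose (homogeneousSubmodule (Fin (n + 1)) k)
          (y * (decompose (homogeneousSubmodule (Fin (n + 1)) k) z j : MvPolynomial (Fin (n + 1)) k)) i :
            MvPolynomial (Fin (n + 1)) k) =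
          decompose (homogeneousSubmodule (Fin (n + 1)) k) y (i - j) *
            (decompose (homogeneousSubmodule (Fin (n + 1)) k) z j : MvPolynomial (Fin (n + 1)) k) :=
        coe_decompose_mul_of_right_mem_of_le (𝒜 := homogeneousSubmodule (Fin (n + 1)) k)
          (SetLike.coe_mem _) hji
      have hyw : (decompose (homogeneousSubmodule (Fin (n + 1)) k) y (i - j) : MvPolynomial (Fin (n + 1)) k) *
          (decompose (homogeneousSubmodule (Fin (n + 1)) k) z j : MvPolynomial (Fin (n + 1)) k) ∈
            homogeneousSubmodule (Fin (n + 1)) k i := by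
        have h := SetLike.mul_mem_graded
          (SetLike.coe_mem (decompose (homogeneousSubmodule (Fin (n + 1)) k) y (i - j)))
          (SetLike.coe_mem (decompose (homogeneousSubmodule (Fin (n + 1)) k) z j))
        rwa [Nat.sub_add_cancel hji] at h
      rw [projGerm_congr hℓ hℓ𝔭 _ hyw e',
        projGerm_mul hℓ hℓ𝔭 (Nat.sub_add_cancel hji) _ _ (SetLike.coe_mem _) (SetLike.coe_mem _) hyw, pow_succ]
      exact Ideal.mul_mem_mul (ih y hy (i - j))
        ((projGerm_mem_maximalIdeal_iff hℓ hℓ𝔭 j _ (SetLike.coe_mem _)).mpr (h𝔭h j hz))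
    · have e' : (decompose (homogeneousSubmodule (Fin (n + 1)) k)
          (y * (decompose (homogeneousSubmodule (Fin (n + 1)) k) z j : MvPolynomial (Fin (n + 1)) k)) i :
            MvPolynomial (Fin (n + 1)) k) = 0 :=
        coe_decompose_mul_of_right_mem_of_not_le (𝒜 := homogeneousSubmodule (Fin (n + 1)) k)
          (SetLike.coe_mem _) hji
      rw [projGerm_congr hℓ hℓ𝔭 _ (Submodule.zero_mem _) e', projGerm_zero]
      exact Ideal.zero_mem _

/-- Homogeneous case of the key step: a form `g ∈ 𝔭^d` of degree `m` has `g/ℓ^m ∈ 𝔪_{Proj,𝔭}^d`. [folklore] -/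
theorem projGerm_mem_pow_of_mem_pow (h𝔭h : 𝔭.IsHomogeneous (homogeneousSubmodule (Fin (n + 1)) k)) {d m : ℕ}
    {g : MvPolynomial (Fin (n + 1)) k} (hg : g ∈ homogeneousSubmodule (Fin (n + 1)) k m) (hgd : g ∈ 𝔭 ^ d) :
    projGerm 𝔭 ℓ hℓ hℓ𝔭 m g hg ∈
      IsLocalRing.maximalIdeal (HomogeneousLocalization.AtPrime (homogeneousSubmodule (Fin (n + 1)) k) 𝔭) ^ d := by
  have e : g = decompose (homogeneousSubmodule (Fin (n + 1)) k) g m := (decompose_of_mem_same _ hg).symm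
  rw [projGerm_congr hℓ hℓ𝔭 hg (SetLike.coe_mem _) e]
  exact projGerm_decompose_mem_pow hℓ hℓ𝔭 h𝔭h d g hgd m

/-- **THE TWO READINGS OF «`mult_𝔭(φ) ≥ d`» AGREE.**  For a homogeneous prime `𝔭 ⊂ S = k[X_0, …, X_n]`, a linear
form `ℓ ∉ 𝔭`, a form `φ` of degree `m` and any `d`:
`φ ∈ 𝔭^{(d)} = 𝔭^d S_𝔭 ∩ S` (the tree's `symbPow`, order `≥ d` in the local ring of the affine cone) **iff**
`φ/ℓ^m ∈ 𝔪^d` in `𝒪_{Proj S,𝔭}` (order `≥ d` in the local ring of the projective space at the point — Hironaka's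
`ν_{x'}(φ/X_0^d) ≥ d`, [H4] p. 154 L24–29).
[cite: Hironaka1970NumericalCharacters, p. 154 L24–29 ({φ ∈ K[X]_d | ν_{x'}(φ/X_0^d) ≥ d}); Mizutani1973HironakaGroupSchemes, p. 85 L23–25 (U_m(p))] -/
theorem mem_symbPow_iff_projGerm_mem_pow (h𝔭h : 𝔭.IsHomogeneous (homogeneousSubmodule (Fin (n + 1)) k))
    {m : ℕ} (φ : MvPolynomial (Fin (n + 1)) k) (hφ : φ ∈ homogeneousSubmodule (Fin (n + 1)) k m) (d : ℕ) :
    φ ∈ symbPow k 𝔭 d ↔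
      projGerm 𝔭 ℓ hℓ hℓ𝔭 m φ hφ ∈
        IsLocalRing.maximalIdeal (HomogeneousLocalization.AtPrime (homogeneousSubmodule (Fin (n + 1)) k) 𝔭) ^ d := by
  constructor
  · rintro ⟨s, hs, hsφ⟩
    -- a homogeneous component `t = s_j ∉ 𝔭` of `s`, with `t φ = (s φ)_{j+m} ∈ 𝔭^d`
    obtain ⟨j, hj⟩ : ∃ j, (decompose (homogeneousSubmodule (Fin (n + 1)) k) s j : MvPolynomial (Fin (n + 1)) k) ∉ 𝔭 := by
      by_contra hall
      push Not at hall
      exact hs ((Ideal.IsHomogeneous.mem_iff _ h𝔭h).mpr hall)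
    have htφ : (decompose (homogeneousSubmodule (Fin (n + 1)) k) s j : MvPolynomial (Fin (n + 1)) k) * φ ∈ 𝔭 ^ d := by
      have e : (decompose (homogeneousSubmodule (Fin (n + 1)) k) (s * φ) (j + m) : MvPolynomial (Fin (n + 1)) k) =
          decompose (homogeneousSubmodule (Fin (n + 1)) k) s (j + m - m) * φ :=
        coe_decompose_mul_of_right_mem_of_le (𝒜 := homogeneousSubmodule (Fin (n + 1)) k) hφ (Nat.le_add_left m j)
      rw [Nat.add_sub_cancel] at e
      rw [← e]
      exact isHomogeneous_pow h𝔭h d (j + m) hsφ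
    have htφm : (decompose (homogeneousSubmodule (Fin (n + 1)) k) s j : MvPolynomial (Fin (n + 1)) k) * φ ∈
        homogeneousSubmodule (Fin (n + 1)) k (j + m) :=
      SetLike.mul_mem_graded (SetLike.coe_mem _) hφ
    have hmem := projGerm_mem_pow_of_mem_pow hℓ hℓ𝔭 h𝔭h htφm htφ
    rw [projGerm_mul hℓ hℓ𝔭 rfl _ _ (SetLike.coe_mem _) hφ htφm] at hmem
    exact (Ideal.unit_mul_mem_iff_mem _ ((isUnit_projGerm_iff hℓ hℓ𝔭 j _ (SetLike.coe_mem _)).mpr hj)).mp hmem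
  · intro h
    -- push the germ into `S_𝔭` along the local map `val`, where `ℓ` becomes a unit
    have hval : (projGerm 𝔭 ℓ hℓ hℓ𝔭 m φ hφ).val ∈ IsLocalRing.maximalIdeal (Localization.AtPrime 𝔭) ^ d := by
      have h1 := Ideal.mem_map_of_mem
        (algebraMap (HomogeneousLocalization.AtPrime (homogeneousSubmodule (Fin (n + 1)) k) 𝔭)
          (Localization.AtPrime 𝔭)) h
      rw [Ideal.map_pow, HomogeneousLocalization.algebraMap_apply] at h1
      exact Ideal.pow_right_mono (map_maximalIdeal_le (𝔭 := 𝔭)) d h1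
    apply exists_mul_mem_pow_of_algebraMap_mem 𝔭
    have e : algebraMap (MvPolynomial (Fin (n + 1)) k) (Localization.AtPrime 𝔭) φ =
        (projGerm 𝔭 ℓ hℓ hℓ𝔭 m φ hφ).val *
          algebraMap (MvPolynomial (Fin (n + 1)) k) (Localization.AtPrime 𝔭) (ℓ ^ m) := by
      rw [val_projGerm, Localization.mk_eq_mk']
      exact (IsLocalization.mk'_spec (Localization.AtPrime 𝔭) φ
        (⟨ℓ ^ m, pow_not_mem_of_not_mem hℓ𝔭 m⟩ : 𝔭.primeCompl)).symm
    rw [e]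
    exact Ideal.mul_mem_right _ _ hval

omit h𝔭 in
/-- Sanity (`d = 1`, any `f`): `symbPow 𝔭 1 = 𝔭` for a prime `𝔭` — consistent with `projGerm_mem_maximalIdeal_iff`.
[folklore] -/
theorem mem_symbPow_one_iff [h𝔭' : 𝔭.IsPrime] (f : MvPolynomial (Fin (n + 1)) k) :
    f ∈ symbPow k 𝔭 1 ↔ f ∈ 𝔭 :=
  ⟨fun h => mem_of_mem_symbPow le_rfl h, fun h =>
    ⟨1, fun h1 => h𝔭'.ne_top ((Ideal.eq_top_iff_one 𝔭).mpr h1), by rwa [pow_one, one_mul]⟩⟩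

end ProjectiveOrder

end Summit.ResolutionOfSingularities.KangarooAtlas.Mizutani

end
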